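import Mathlib
import Literature.Analysis.ODE.CodeListSimplification
import Summits.Ventures.FusionMHD.Models.CerfonFreidbergIterLikeQHalfLevel
import Summits.Ventures.FusionMHD.Models.CerfonFreidbergIterLikeAxisTight
import HarnessLib

/-!
# Ventures/FusionMHD — Models/CerfonFreidbergIterLikeQHalfStrip.lean: the per-panel STRIP / TUBE FACTS of ★ #117's certificates,
# exported once for every register link, and the THIRD RAY DERIVATIVE `F3field = ∂_s F2field` of THE Cerfon–Freidberg ITER-like flux
# (symbolic, constant-folded code list; range boxes by the natural interval extension)

HONEST FRAMING (LADDER-GRIDFUSION three columns; CF rung, F2 item R2; «F2.R2-CF-SHEAR-ITER» / «F2.R2-CF-MERCIER-IMPLICIT» step (4) of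
`pub/gridfusion/models/F2-SCOPING.md` v1.6 §10(c), infrastructure, LOW, no count).
* §1 **`StripFacts`** (a `Prop` structure) and **`stripFacts_of_check`**: for a panel `j` whose records `d : PanelCert`, `b : BoxData`,
  `ℓ : LinkData` pass `d.ok`, `b.ok`, `ℓ.check d b` (all ALREADY decided in the tree, `…QHalfData` / `…QHalfLevel`), on
  `Θ_j = [π·2jh, π·(2j+2)h]`: the approximant `mθ` lies in `[m⁻, m⁺]`, the flux residual at `mθ` is `≤ η`, `D_r(θ, mθ) ∈ [d⁻, d⁺]`,
  `D_r` is `M`-Lipschitz in `s` on the strip `[s_A, s_max]`, `|F2field| ≤ M` there, and the rational constants satisfy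
  `s_A + r ≤ m⁻`, `m⁺ + r ≤ s_max`, `η < r(d⁻ − Mr)` — exactly the per-`θ` facts DERIVED INSIDE `…QHalfPanel.panel_bracket` (model-5 g7),
  here stated once so that every register link (shear, `V″`, the four `⟨·⟩`) consumes them BY NAME; consequences `tube_sub`,
  `tube_D`, `tube_R`, `tube_abs`.
* §2 **THE THIRD RAY DERIVATIVE**: `d1S/d2S/d3S` = the constant-folded derived code lists `∂_s, ∂_s², ∂_s³` of `PolarPanel.gExpr`
  (Moore (4.21) with Moore's constant-operand remark, `FExpr.pderivS`), `F3field θ s := d3S.eval (pt θ s)`; **`d2S_eval_eq`**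
  (`= F2field`, via uniqueness of derivatives along the coordinate line) and **`hasDerivAt_F2field`**:
  `HasDerivAt (F2field θ) (F3field θ s) s` wherever `X = X_a + s cos θ > 0` — no closed form of `U_XXX …` is ever written.
* §3 **RANGE BOXES**: `regionBox` (the instance's `tightBox` coordinates × a `θ`-range × an `s`-range), `pt_mem_regionBox`, and
  **`F3_abs_le_of_evalBoxLE`**: a natural-extension certificate `evalBoxLE cfg d3S (regionBox …) [−M₃, M₃] = true` gives `|F3field| ≤ M₃`
  on the box, hence (`F2_lipschitz_of_F3`) `F2field(θ, ·)` is `M₃`-Lipschitz there.  (No `decide` in this file; the eight boxes of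
  record are decided in `…QHalfShearLink`.)
CERTIFIED: kernel, this file + imports (axioms standard).  VALIDATED: nothing used.  MODELLED: analytic Cerfon–Freidberg family
(ideal MHD, Solov'ev profiles, α = 0); derivatives of a MODEL flux — nothing about a device or stability.
Typer/prover: gridfusion-model-7 (g7), 2026-08-27.  Citations: Moore 1979 §3.4, §4.3 (4.21) [Moore1979]; Freidberg 2014 §6.6.1 (6.153)
[Freidberg2014].
-/

noncomputable section

open Set MeasureTheory intervalIntegral Filter Topology NonemptyInterval
open Literature.Analysis.ODE Literature.Analysis.ODE.FExpr
open Literature.Analysis.ValidatedNumerics Literature.Analysis.ValidatedNumerics.PolyMP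
open Literature.Analysis.ValidatedNumerics.NumericsMP Literature.Analysis.ValidatedNumerics.ExpPoly
open Literature.Analysis.ValidatedNumerics.ITaylor
open Literature.MathematicalPhysics.MHD Literature.MathematicalPhysics.MHD.CerfonFreidberg
open Summit.Ventures.FusionMHD.Models.PolarRay
open Summit.Ventures.FusionMHD.Models.CFIterLike.PolarPanel

set_option autoImplicit false

namespace Summit.Ventures.FusionMHD.Models.CFIterLike.QHalf

/-! ## §1 The strip / tube facts of one certified panel -/

/-- **The per-panel facts** on `Θ = [a, a′]` with strip `[s_A, s_max]`, tube radius `r`, Lipschitz constant `M`, residual bound `η`,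
approximant range `[m⁻, m⁺]` and slope range `[d⁻, d⁺]` at the approximant (all real numbers; the instance's objects `U`, `X_a`, `u₀`,
`mθ`, `Dfield`, `F2field` are fixed). [folklore] -/
structure StripFacts (a a' sA smax r M η mlo mhi dlo dhi : ℝ) : Prop where
  /-- `0 < r` -/
  hr : 0 < r
  /-- `0 < s_A` -/
  hsA : 0 < sA
  /-- `s_max < 1` -/
  hsmax : smax < 1
  /-- the tube bottom stays in the strip -/
  hsAr : sA + r ≤ mlo
  /-- the tube top stays in the strip -/
  hmr : mhi + r ≤ smax
  /-- `0 ≤ M` -/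
  hM : 0 ≤ M
  /-- `0 < d⁻ − M r` (positive slope on the tube) -/
  hμ : 0 < dlo - M * r
  /-- residual versus slope: `η < r (d⁻ − M r)` -/
  hημ : η < r * (dlo - M * r)
  /-- the approximant lies in `[m⁻, m⁺]` -/
  m_mem : ∀ θ ∈ Icc a a', mlo ≤ mθ θ ∧ mθ θ ≤ mhi
  /-- the flux residual at the approximant -/
  res : ∀ θ ∈ Icc a a', |rayProfile U Xa 0 θ (mθ θ) - u₀| ≤ η
  /-- the radial derivative at the approximant -/
  D_m : ∀ θ ∈ Icc a a', dlo ≤ Dfield θ (mθ θ) ∧ Dfield θ (mθ θ) ≤ dhi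
  /-- `D_r` is `M`-Lipschitz in `s` on the strip -/
  lip : ∀ θ ∈ Icc a a', ∀ s ∈ Icc sA smax, ∀ s' ∈ Icc sA smax, |Dfield θ s - Dfield θ s'| ≤ M * |s - s'|
  /-- `|∂_s D_r| ≤ M` on the strip -/
  F2_abs : ∀ θ ∈ Icc a a', ∀ s ∈ Icc sA smax, |F2field θ s| ≤ M

section facts

variable {d : PanelCert} {b : BoxData} {ℓ : LinkData}

set_option maxHeartbeats 1600000 in
/-- **ONE CERTIFIED PANEL ⇒ `StripFacts`** with the constants of its three records (`r = ℓ.r`, `M = b.M`, `η = eta/2⁶⁰`, `m∓ = mlo/mhi/2⁶⁰`,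
`d∓ = dlo/dhi/2⁶⁰`).  The derivation is the one inside `…QHalfPanel.panel_bracket` (model-5 g7), exported. -/
theorem stripFacts_of_check (hd : d.ok = true) (hb : b.ok = true) (hℓ : ℓ.check d b = true) :
    StripFacts (Real.pi * ((panelLeft hw d.j : ℚ) : ℝ)) (Real.pi * ((panelLeft hw (d.j + 1) : ℚ) : ℝ))
      ((b.sA : ℚ) : ℝ) ((b.smax : ℚ) : ℝ) ((ℓ.r : ℚ) : ℝ) ((b.M : ℚ) : ℝ) ((d.eta : ℝ) / ((tmS : ℕ) : ℝ))
      ((d.mlo : ℝ) / ((tmS : ℕ) : ℝ)) ((d.mhi : ℝ) / ((tmS : ℕ) : ℝ)) ((d.dlo : ℝ) / ((tmS : ℕ) : ℝ)) ((d.dhi : ℝ) / ((tmS : ℕ) : ℝ)) := by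
  set a : ℝ := Real.pi * ((panelLeft hw d.j : ℚ) : ℝ) with ha_def
  set a' : ℝ := Real.pi * ((panelLeft hw (d.j + 1) : ℚ) : ℝ) with ha'_def
  -- unpack the rational side conditions
  simp only [LinkData.check, Bool.and_eq_true, decide_eq_true_eq] at hℓ
  obtain ⟨⟨⟨⟨⟨⟨⟨⟨⟨⟨⟨⟨⟨⟨⟨⟨⟨⟨⟨⟨⟨⟨⟨⟨⟨-, -⟩, cthlo⟩, cthhi⟩, csA0⟩, csA⟩, csmax⟩, cr0⟩, crμ⟩, -⟩, -⟩, -⟩, -⟩,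
    -⟩, cM0⟩, -⟩, -⟩, -⟩, -⟩, -⟩, -⟩, -⟩, crD⟩, -⟩, -⟩, -⟩ := hℓ
  -- the kernel facts
  obtain ⟨-, hres, hm, hD⟩ := sound_of_ok hd
  obtain ⟨-, hB2⟩ := BoxData.sound hb
  have hbok := hb
  simp only [BoxData.ok, Bool.and_eq_true, decide_eq_true_eq] at hbok
  obtain ⟨⟨⟨⟨⟨⟨⟨⟨⟨-, -⟩, -⟩, -⟩, -⟩, -⟩, -⟩, hsmax1⟩, -⟩, -⟩ := hbok
  -- real versions of the constants
  have hS : (0 : ℝ) < ((tmS : ℕ) : ℝ) := by exact_mod_cast tmS_pos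
  have hpi := Real.pi_pos
  have hpiLo : ((piLoQ : ℚ) : ℝ) < Real.pi := by have := Real.pi_gt_d20; norm_num [piLoQ] at this ⊢; exact this
  have hpiHi : Real.pi < ((piHiQ : ℚ) : ℝ) := by have := Real.pi_lt_d20; norm_num [piHiQ] at this ⊢; exact this
  have hpl0 : (0 : ℚ) ≤ panelLeft hw d.j := by unfold panelLeft hw; positivity
  have hθbox : ∀ θ ∈ Icc a a', θ ∈ Icc ((b.thlo : ℚ) : ℝ) ((b.thhi : ℚ) : ℝ) := by
    intro θ hθ
    have h1 : ((b.thlo : ℚ) : ℝ) ≤ a := by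
      have : ((b.thlo : ℚ) : ℝ) ≤ ((piLoQ : ℚ) : ℝ) * ((panelLeft hw d.j : ℚ) : ℝ) := by exact_mod_cast cthlo
      have h2 : ((piLoQ : ℚ) : ℝ) * ((panelLeft hw d.j : ℚ) : ℝ) ≤ a :=
        mul_le_mul_of_nonneg_right hpiLo.le (by exact_mod_cast hpl0)
      linarith
    have h2 : a' ≤ ((b.thhi : ℚ) : ℝ) := by
      have : ((piHiQ : ℚ) : ℝ) * ((panelLeft hw (d.j + 1) : ℚ) : ℝ) ≤ ((b.thhi : ℚ) : ℝ) := by exact_mod_cast cthhi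
      have hpl1 : (0 : ℝ) ≤ ((panelLeft hw (d.j + 1) : ℚ) : ℝ) := by
        exact_mod_cast (show (0 : ℚ) ≤ panelLeft hw (d.j + 1) by unfold panelLeft hw; positivity)
      have h3 : a' ≤ ((piHiQ : ℚ) : ℝ) * ((panelLeft hw (d.j + 1) : ℚ) : ℝ) := mul_le_mul_of_nonneg_right hpiHi.le hpl1
      linarith
    exact ⟨h1.trans hθ.1, hθ.2.trans h2⟩
  have hθt : ∀ θ ∈ Icc a a', |θ / Real.pi - ((ctr d.j : ℚ) : ℝ)| ≤ ((hw : ℚ) : ℝ) := by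
    intro θ hθ
    have e1 : ((ctr d.j : ℚ) : ℝ) = ((panelLeft hw d.j : ℚ) : ℝ) + ((hw : ℚ) : ℝ) := by
      simp only [ctr, panelLeft]; push_cast; ring
    have ht1 : ((panelLeft hw d.j : ℚ) : ℝ) ≤ θ / Real.pi := by
      rw [le_div_iff₀ hpi]; linarith [hθ.1, mul_comm Real.pi (((panelLeft hw d.j : ℚ) : ℝ))]
    have ht2 : θ / Real.pi ≤ ((panelLeft hw (d.j + 1) : ℚ) : ℝ) := by
      rw [div_le_iff₀ hpi]; linarith [hθ.2, mul_comm Real.pi (((panelLeft hw (d.j + 1) : ℚ) : ℝ))]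
    have e2 : ((panelLeft hw (d.j + 1) : ℚ) : ℝ) = ((panelLeft hw d.j : ℚ) : ℝ) + 2 * ((hw : ℚ) : ℝ) := by
      simp only [panelLeft]; push_cast; ring
    rw [e1, abs_le]; constructor <;> linarith
  -- per-θ facts from the panel certificate
  have hθm : ∀ θ ∈ Icc a a', ((d.mlo : ℝ) / ((tmS : ℕ) : ℝ)) ≤ mθ θ ∧ mθ θ ≤ ((d.mhi : ℝ) / ((tmS : ℕ) : ℝ)) := by
    intro θ hθ
    have h := hm (θ / Real.pi - ((ctr d.j : ℚ) : ℝ)) (hθt θ hθ)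
    simp only [add_sub_cancel] at h
    exact h
  have hθres : ∀ θ ∈ Icc a a', |rayProfile U Xa 0 θ (mθ θ) - u₀| ≤ ((d.eta : ℝ) / ((tmS : ℕ) : ℝ)) := by
    intro θ hθ
    have h := hres (θ / Real.pi - ((ctr d.j : ℚ) : ℝ)) (hθt θ hθ)
    simp only [add_sub_cancel] at h
    have e : Real.pi * (θ / Real.pi) = θ := mul_div_cancel₀ θ hpi.ne'
    unfold resid at h
    rw [e] at h
    unfold rayProfile u₀ mθ
    rw [zero_add]
    exact h
  have hθD : ∀ θ ∈ Icc a a', ((d.dlo : ℝ) / ((tmS : ℕ) : ℝ)) ≤ Dfield θ (mθ θ) ∧ Dfield θ (mθ θ) ≤ ((d.dhi : ℝ) / ((tmS : ℕ) : ℝ)) := by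
    intro θ hθ
    have h := hD (θ / Real.pi - ((ctr d.j : ℚ) : ℝ)) (hθt θ hθ)
    simp only [add_sub_cancel] at h
    have e : Real.pi * (θ / Real.pi) = θ := mul_div_cancel₀ θ hpi.ne'
    unfold DrA at h
    rw [e] at h
    exact h
  -- constants in ℝ
  have hsA0 : 0 < ((b.sA : ℚ) : ℝ) := by exact_mod_cast csA0
  have hsAr : ((b.sA : ℚ) : ℝ) + ((ℓ.r : ℚ) : ℝ) ≤ ((d.mlo : ℝ) / ((tmS : ℕ) : ℝ)) := by
    have := (show ((b.sA + ℓ.r : ℚ) : ℝ) ≤ (((d.mlo : ℚ) / tmS : ℚ) : ℝ) by exact_mod_cast csA); push_cast at this; exact this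
  have hmhir : ((d.mhi : ℝ) / ((tmS : ℕ) : ℝ)) + ((ℓ.r : ℚ) : ℝ) ≤ ((b.smax : ℚ) : ℝ) := by
    have := (show ((((d.mhi : ℚ) / tmS + ℓ.r : ℚ)) : ℝ) ≤ ((b.smax : ℚ) : ℝ) by exact_mod_cast csmax); push_cast at this; exact this
  have hr0 : 0 < ((ℓ.r : ℚ) : ℝ) := by exact_mod_cast cr0
  have hrμ : ((d.eta : ℝ) / ((tmS : ℕ) : ℝ)) < ((ℓ.r : ℚ) : ℝ) * (((d.dlo : ℝ) / ((tmS : ℕ) : ℝ)) - ((b.M : ℚ) : ℝ) * ((ℓ.r : ℚ) : ℝ)) := by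
    have := (show ((((d.eta : ℚ) / tmS : ℚ)) : ℝ) < ((ℓ.r * ((d.dlo : ℚ) / tmS - b.M * ℓ.r) : ℚ) : ℝ) by exact_mod_cast crμ)
    push_cast at this; exact this
  have hM0 : 0 ≤ ((b.M : ℚ) : ℝ) := by exact_mod_cast cM0
  have crD' : ((b.M : ℚ) : ℝ) * ((ℓ.r : ℚ) : ℝ) < ((d.dlo : ℝ) / ((tmS : ℕ) : ℝ)) := by
    have := (show ((b.M * ℓ.r : ℚ) : ℝ) < ((((d.dlo : ℚ) / tmS : ℚ)) : ℝ) by exact_mod_cast crD); push_cast at this; exact this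
  have hsmax1 : ((b.smax : ℚ) : ℝ) < 1 := by exact_mod_cast hsmax1
  -- derivative of D on [0, smax] and the Lipschitz bound on the strip
  have hderD : ∀ θ s, 0 ≤ s → s ≤ ((b.smax : ℚ) : ℝ) → HasDerivAt (fun x => Dfield θ x) (F2c coeff Xa s θ) s := by
    intro θ s h0 h1; exact hasDerivAt_Drc (X_pos h0 (h1.trans_lt hsmax1))
  have hLip : ∀ θ ∈ Icc a a', ∀ s ∈ Icc ((b.sA : ℚ) : ℝ) ((b.smax : ℚ) : ℝ), ∀ s' ∈ Icc ((b.sA : ℚ) : ℝ) ((b.smax : ℚ) : ℝ),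
      |Dfield θ s - Dfield θ s'| ≤ ((b.M : ℚ) : ℝ) * |s - s'| := by
    intro θ hθ s hs s' hs'
    have h := Convex.norm_image_sub_le_of_norm_hasDerivWithin_le (f := fun x => Dfield θ x) (f' := fun x => F2c coeff Xa x θ)
      (s := Icc ((b.sA : ℚ) : ℝ) ((b.smax : ℚ) : ℝ)) (fun x hx => (hderD θ x (hsA0.le.trans hx.1) hx.2).hasDerivWithinAt)
      (fun x hx => by rw [Real.norm_eq_abs]; exact hB2 θ (hθbox θ hθ) x hx) (convex_Icc _ _) hs' hs
    rw [Real.norm_eq_abs, Real.norm_eq_abs] at h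
    exact h
  exact
    { hr := hr0
      hsA := hsA0
      hsmax := hsmax1
      hsAr := hsAr
      hmr := hmhir
      hM := hM0
      hμ := by linarith
      hημ := hrμ
      m_mem := hθm
      res := hθres
      D_m := hθD
      lip := hLip
      F2_abs := fun θ hθ s hs => hB2 θ (hθbox θ hθ) s hs }

end facts

namespace StripFacts

variable {a a' sA smax r M η mlo mhi dlo dhi : ℝ}

/-- The tube `|s − mθ| ≤ r` lies inside the strip. -/
theorem tube_sub (P : StripFacts a a' sA smax r M η mlo mhi dlo dhi) {θ : ℝ} (hθ : θ ∈ Icc a a') {s : ℝ}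
    (hs : s ∈ Icc (mθ θ - r) (mθ θ + r)) : s ∈ Icc sA smax := by
  obtain ⟨h1, h2⟩ := P.m_mem θ hθ
  exact ⟨by linarith [hs.1, P.hsAr], by linarith [hs.2, P.hmr]⟩

/-- The approximant itself lies in the strip. -/
theorem m_sub (P : StripFacts a a' sA smax r M η mlo mhi dlo dhi) {θ : ℝ} (hθ : θ ∈ Icc a a') : mθ θ ∈ Icc sA smax :=
  P.tube_sub hθ ⟨by linarith [P.hr], by linarith [P.hr]⟩

/-- The tube ends are in the strip: `s_A ≤ mθ − r` and `mθ + r ≤ s_max`. -/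
theorem tube_ends (P : StripFacts a a' sA smax r M η mlo mhi dlo dhi) {θ : ℝ} (hθ : θ ∈ Icc a a') :
    sA ≤ mθ θ - r ∧ mθ θ + r ≤ smax := by
  obtain ⟨h1, h2⟩ := P.m_mem θ hθ
  exact ⟨by linarith [P.hsAr], by linarith [P.hmr]⟩

/-- **`D_r` on the tube**: `d⁻ − Mr ≤ Dfield θ s ≤ d⁺ + Mr` and `|Dfield θ s − Dfield θ (mθ θ)| ≤ Mr`. -/
theorem tube_D (P : StripFacts a a' sA smax r M η mlo mhi dlo dhi) {θ : ℝ} (hθ : θ ∈ Icc a a') {s : ℝ}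
    (hs : s ∈ Icc (mθ θ - r) (mθ θ + r)) :
    |Dfield θ s - Dfield θ (mθ θ)| ≤ M * r ∧ dlo - M * r ≤ Dfield θ s ∧ Dfield θ s ≤ dhi + M * r := by
  have hL := P.lip θ hθ s (P.tube_sub hθ hs) (mθ θ) (P.m_sub hθ)
  have hsm : |s - mθ θ| ≤ r := abs_le.2 ⟨by linarith [hs.1], by linarith [hs.2]⟩
  have h1 : |Dfield θ s - Dfield θ (mθ θ)| ≤ M * r := hL.trans (mul_le_mul_of_nonneg_left hsm P.hM)
  have h2 := abs_le.1 h1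
  obtain ⟨hD1, hD2⟩ := P.D_m θ hθ
  exact ⟨h1, by linarith [h2.1], by linarith [h2.2]⟩

/-- Every strip point has `0 ≤ s < 1`, hence `X = X_a + s cos θ > 0`. -/
theorem strip_X_pos (P : StripFacts a a' sA smax r M η mlo mhi dlo dhi) {θ s : ℝ} (hs : s ∈ Icc sA smax) :
    0 < Xa + s * Real.cos θ :=
  X_pos_of_box P.hsA.le P.hsmax hs

/-- **`R = X_a + s cos θ` on the strip**: `X_a − s_max ≤ R ≤ X_a + s_max`, and `|R_s − R_{s′}| ≤ |s − s′|`. -/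
theorem strip_R (P : StripFacts a a' sA smax r M η mlo mhi dlo dhi) {θ s : ℝ} (hs : s ∈ Icc sA smax) :
    Xa - smax ≤ Xa + s * Real.cos θ ∧ Xa + s * Real.cos θ ≤ Xa + smax := by
  have hc1 := Real.neg_one_le_cos θ; have hc2 := Real.cos_le_one θ
  have hs0 : 0 ≤ s := P.hsA.le.trans hs.1
  have h1 := mul_le_mul_of_nonneg_left hc1 hs0
  have h2 := mul_le_mul_of_nonneg_left hc2 hs0
  constructor <;> linarith [hs.2]

/-- `|(X_a + s cos θ) − (X_a + s′ cos θ)| ≤ |s − s′|`. -/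
theorem R_sub_abs (θ s s' : ℝ) : |(Xa + s * Real.cos θ) - (Xa + s' * Real.cos θ)| ≤ |s - s'| := by
  rw [show (Xa + s * Real.cos θ) - (Xa + s' * Real.cos θ) = (s - s') * Real.cos θ by ring, abs_mul]
  exact mul_le_of_le_one_right (abs_nonneg _) (Real.abs_cos_le_one θ)

end StripFacts

/-! ## §2 The third ray derivative `F3field = ∂_s F2field`, symbolically -/

/-- The constant-folded code list of `∂_s G` (`G = U(ray) − U_a/2`, `PolarPanel.gExpr`). -/
def d1S : FExpr 11 := pderivS 10 gExpr
/-- The constant-folded code list of `∂_s² G`. -/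
def d2S : FExpr 11 := pderivS 10 d1S
/-- The constant-folded code list of `∂_s³ G` — the third ray derivative. -/
def d3S : FExpr 11 := pderivS 10 d2S

/-- **`F3field θ s`** — the third derivative of the ray profile `s ↦ U(X_a + s cos θ, s sin θ)`, as the value of the folded code list at the
instance point (no closed form written). -/
def F3field (θ s : ℝ) : ℝ := d3S.eval (pt θ s)

/-- Uniqueness along a coordinate line: code lists with the same TOTAL function have the same derived value at common domain points. [folklore] -/
theorem eval_pderiv_congr {n : ℕ} (k : Fin n) {e₁ e₂ : FExpr n} (h : ∀ z, e₁.eval z = e₂.eval z) {y : Fin n → ℝ}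
    (h₁ : e₁.dom y) (h₂ : e₂.dom y) : (pderiv k e₁).eval y = (pderiv k e₂).eval y := by
  have hy : Function.update y k (y k) = y := Function.update_eq_self k y
  have d₁ := hasDerivAt_eval_update k y e₁ (s := y k) (by rw [hy]; exact h₁)
  have d₂ := hasDerivAt_eval_update k y e₂ (s := y k) (by rw [hy]; exact h₂)
  rw [hy] at d₁ d₂
  have hfun : (fun r => e₁.eval (Function.update y k r)) = fun r => e₂.eval (Function.update y k r) :=
    funext fun r => h (Function.update y k r)
  rw [hfun] at d₁
  exact d₁.unique d₂

/-- `d1S` has the same function as `dExpr` (everywhere). -/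
theorem d1S_eval (z : Fin 11 → ℝ) : d1S.eval z = dExpr.eval z := eval_pderivS 10 z gExpr

/-- Domains: `X > 0` at `y` puts `y` in the domain of `gExpr`, `dExpr`, `d1S`, `d2S`, `d3S`, `dExpr.pderiv 10`. -/
theorem doms_of_X_pos {y : Fin 11 → ℝ} (hX : 0 < y 7 + y 10 * Real.cos (y 9)) :
    gExpr.dom y ∧ dExpr.dom y ∧ d1S.dom y ∧ d2S.dom y ∧ d3S.dom y ∧ (dExpr.pderiv 10).dom y := by
  have hg := gExpr_dom hX
  have h1 : d1S.dom y := dom_pderivS 10 gExpr hg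
  have h2 : d2S.dom y := dom_pderivS 10 d1S h1
  exact ⟨hg, dom_pderiv 10 gExpr hg, h1, h2, dom_pderivS 10 d2S h2, dom_pderiv 10 _ (dom_pderiv 10 gExpr hg)⟩

/-- **`d2S` IS `F2field`** at every instance point with `X > 0`. -/
theorem d2S_eval_eq {θ s : ℝ} (hX : 0 < Xa + s * Real.cos θ) : d2S.eval (pt θ s) = F2field θ s := by
  obtain ⟨e7, e9, e10⟩ := pt_coords θ s
  have hX' : 0 < pt θ s 7 + pt θ s 10 * Real.cos (pt θ s 9) := by rw [e7, e9, e10]; exact hX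
  obtain ⟨-, hd, h1, -, -, -⟩ := doms_of_X_pos hX'
  unfold d2S
  rw [eval_pderivS 10 (pt θ s) d1S, eval_pderiv_congr 10 d1S_eval h1 hd, ddExpr_eval_eq _ hX'.ne', cOf_pt, e7, e9, e10]
  rfl

/-- **THE THIRD RAY DERIVATIVE**: for `X = X_a + s cos θ > 0`, `HasDerivAt (F2field θ) (F3field θ s) s`. -/
theorem hasDerivAt_F2field {θ s : ℝ} (hX : 0 < Xa + s * Real.cos θ) : HasDerivAt (F2field θ) (F3field θ s) s := by
  obtain ⟨e7, e9, e10⟩ := pt_coords θ s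
  have hX' : 0 < pt θ s 7 + pt θ s 10 * Real.cos (pt θ s 9) := by rw [e7, e9, e10]; exact hX
  obtain ⟨-, -, -, h2, -, -⟩ := doms_of_X_pos hX'
  have hd := hasDerivAt_eval_update 10 (pt θ s) d2S (s := s) (by rw [update_pt]; exact h2)
  rw [update_pt] at hd
  have hv : (pderiv 10 d2S).eval (pt θ s) = F3field θ s := by
    unfold F3field d3S; rw [eval_pderivS 10 (pt θ s) d2S]
  rw [hv] at hd
  -- the function agrees with `F2field θ` near `s` (where `X > 0`, an open condition)
  have hopen : ∀ᶠ r in 𝓝 s, d2S.eval (Function.update (pt θ s) 10 r) = F2field θ r := by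
    have hc : ContinuousAt (fun r : ℝ => Xa + r * Real.cos θ) s := by fun_prop
    have hev : ∀ᶠ r in 𝓝 s, 0 < Xa + r * Real.cos θ := hc.eventually (Ioi_mem_nhds hX)
    filter_upwards [hev] with r hr
    rw [update_pt, d2S_eval_eq hr]
  exact hd.congr_of_eventuallyEq (Filter.EventuallyEq.symm hopen)

/-! ## §3 Range boxes for `F3field` by the natural interval extension -/

/-- **The region box**: coordinates 0–6, 7, 8 = the instance's `tightBox` coordinates 0–6, 8, 17 (`…AxisTight`); 9 = `[θ⁻, θ⁺]`; 10 = `[s⁻, s⁺]`. -/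
def regionBox (tlo thi slo shi : ℚ) (hθ : tlo ≤ thi) (hs : slo ≤ shi) : Fin 11 → Iv := fun i =>
  if h : (i : ℕ) < 7 then tightBox ⟨i, by omega⟩
  else if (i : ℕ) = 7 then tightBox 8
  else if (i : ℕ) = 8 then tightBox 17
  else if (i : ℕ) = 9 then ⟨(tlo, thi), hθ⟩ else ⟨(slo, shi), hs⟩

/-- `pt θ s` lies in the region box whenever `θ ∈ [θ⁻, θ⁺]` and `s ∈ [s⁻, s⁺]`. -/
theorem pt_mem_regionBox {tlo thi slo shi : ℚ} (hθ : tlo ≤ thi) (hs : slo ≤ shi) {θ s : ℝ}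
    (hθm : ((tlo : ℚ) : ℝ) ≤ θ ∧ θ ≤ ((thi : ℚ) : ℝ)) (hsm : ((slo : ℚ) : ℝ) ≤ s ∧ s ≤ ((shi : ℚ) : ℝ)) :
    pt θ s ∈ boxSet (castBox (regionBox tlo thi slo shi hθ hs)) := by
  have hz := mem_boxSet_iff.mp axZero_mem_tightBox
  rw [mem_boxSet_iff]
  intro i
  rw [castBox_apply, mem_ratCast_iff]
  by_cases hi : (i : ℕ) < 7
  · have h := hz ⟨i, by omega⟩
    rw [castBox_apply, mem_ratCast_iff] at h
    simp only [regionBox, pt, hi, dif_pos]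
    exact h
  · by_cases h7 : (i : ℕ) = 7
    · have h := hz 8
      rw [castBox_apply, mem_ratCast_iff] at h
      simp only [regionBox, pt, h7]
      exact h
    · by_cases h8 : (i : ℕ) = 8
      · have h := hz 17
        rw [castBox_apply, mem_ratCast_iff] at h
        simp only [regionBox, pt, h8]
        exact h
      · by_cases h9 : (i : ℕ) = 9
        · simp only [regionBox, pt, h9]
          exact hθm
        · simp only [regionBox, pt, hi, h7, h8, h9, dif_neg, not_false_eq_true, if_false]
          exact hsm

/-- **RANGE CERTIFICATE ⇒ `|F3field| ≤ M₃` ON THE BOX.** -/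
theorem F3_abs_le_of_evalBoxLE {cfg : SeedCfg} {tlo thi slo shi M3 : ℚ} {hθ : tlo ≤ thi} {hs : slo ≤ shi} {hM : -M3 ≤ M3}
    (h : evalBoxLE cfg d3S (regionBox tlo thi slo shi hθ hs) ⟨(-M3, M3), hM⟩ = true) {θ s : ℝ}
    (hθm : ((tlo : ℚ) : ℝ) ≤ θ ∧ θ ≤ ((thi : ℚ) : ℝ)) (hsm : ((slo : ℚ) : ℝ) ≤ s ∧ s ≤ ((shi : ℚ) : ℝ)) :
    |F3field θ s| ≤ ((M3 : ℚ) : ℝ) := by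
  have hm := eval_mem_of_evalBoxLE h (pt_mem_regionBox hθ hs hθm hsm)
  rw [mem_ratCast_iff] at hm
  unfold F3field
  rw [abs_le]
  constructor
  · have := hm.1; push_cast at this; exact this
  · exact hm.2

/-- **`|F3| ≤ M₃` on `Θ × [s⁻, s⁺]` (with `0 ≤ s⁻`, `s⁺ < 1`) ⇒ `F2field(θ, ·)` is `M₃`-Lipschitz there.** -/
theorem F2_lipschitz_of_F3 {θ slo shi M3 : ℝ} (h0 : 0 ≤ slo) (h1 : shi < 1)
    (hF3 : ∀ s ∈ Icc slo shi, |F3field θ s| ≤ M3) {s s' : ℝ} (hs : s ∈ Icc slo shi) (hs' : s' ∈ Icc slo shi) :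
    |F2field θ s - F2field θ s'| ≤ M3 * |s - s'| := by
  have h := Convex.norm_image_sub_le_of_norm_hasDerivWithin_le (f := F2field θ) (f' := F3field θ) (s := Icc slo shi)
    (fun x hx => (hasDerivAt_F2field (X_pos_of_box h0 h1 hx)).hasDerivWithinAt)
    (fun x hx => by rw [Real.norm_eq_abs]; exact hF3 x hx) (convex_Icc _ _) hs' hs
  rw [Real.norm_eq_abs, Real.norm_eq_abs] at h
  exact h

end Summit.Ventures.FusionMHD.Models.CFIterLike.QHalf

end
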